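import Literature.RingTheory.Derivation.SliceDecomposition
import HarnessLib

/-!
# Crux `Steer` (stmt-ResolutionOfSingularities-16345), chain W4.1 — registered stub `stub_logFinalExitM`
# (r16), E1 half, piece **L1 `contentFrame`**: the commuting `p`-nilpotent frame of `ker (d f / h)`

OURS (campaign `res-hironaka`, rung L, slot W4.1, chain W4.1; seat res-D-pv-014 AS res-L0-w41-stub-9;
replaces the role of no printed item; NOT a statement of the manuscript under review
[claim: Hironaka2017, status: under-review]; AI review is weaker than expert review). Sub-stub L1 of
res-L0-w41-idea-2's `PLAN-LogFinalExitM.md` for the registered stub `stub_logFinalExitM` of the line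
`switching_dichotomy` (holder res-L0-w41-lead-1, skeleton r16): PURE COMMUTATIVE ALGEBRA, Theses-free.

## Setting and statements

`A` a commutative ring, `y : ι → A` a finite family and `Δ : ι → Der_ℤ(A)` DUAL to it
(`Δ i (y j) = δ_ij`) which DETERMINES derivations (`hdet`: a `ℤ`-derivation of `A` killing every `y i`
is zero — for a regular local ring of characteristic `p` with perfect residue field, F-finite, and `y`
a regular system of parameters this is the Kunz `p`-basis, see `derivation_eq_zero_of_span`).

* `eq_sum_smul` — every `δ ∈ Der_ℤ(A)` is `∑ i, δ (y i) • Δ i`.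
* `exists_isUnit_coeff` — CONTENT INVERTIBLE ⇒ UNIT COEFFICIENT: if `A` is a local domain, `h ≠ 0`,
  `Δ i f = h * a i` for all `i` and some derivation takes the value `h * u` at `f` with `u` a unit,
  then some `a i` is a unit.
* the FRAME (`ι = Fin (n + 1)`, `a 0` a unit): `j ↦ Δ (j+1) - (a (j+1) / a 0) • Δ 0`
  (`j : Fin n`) kills `f` and is dual to `y 1, …, y n`; a derivation killing `f` and
  `y 1, …, y n` is ZERO (`eq_zero_of_apply_eq_zero`); hence the frame COMMUTES (`frame_comm`) and is
  `p`-NILPOTENT in characteristic `p` (`iterate_frame_prime`, via the tree's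
  bundled `p`-th power `Literature.RingTheory.Derivation.iteratePrime`). This is the first step of
  the Frobenius theorem for the corank-one foliation `𝓕 = {δ | δ f = 0} = ker (δ ↦ δ f / h)`;
  characteristic `p` costs nothing here.
* `derivation_eq_zero_of_span` — the determination hypothesis from a spanning set of monomials over
  a subring of `p`-th powers (the shape of the tree's
  `S02Preliminaries.span_frobeniusPower_monomials_eq_top_of_isFFinite`).

Sources: H. Matsumura, *Commutative Ring Theory*, §25 (restricted Lie algebra of derivations,
Thm. 25.5) and §30 (dual derivations of a regular system of parameters); the frame computation is
folklore (Frobenius theorem, first step). [cite: Matsumura1987, §25, §30] [folklore]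
No definitions (the frame is written out in each statement); `exists_frame` packages everything.
-/

noncomputable section

-- `Summit.<S>.<S>.…` duplicates the summit name by design (single-problem summit).
set_option linter.dupNamespace false
set_option autoImplicit false

namespace Summit.ResolutionOfSingularities.ResolutionOfSingularities.Theorems.SwitchingDichotomy

namespace ContentFrame

open Literature.RingTheory.Derivation

variable {A : Type*} [CommRing A]

/-! ## Sums of scaled derivations, evaluated -/

/-- `(∑ i, c i • Δ i) b = ∑ i, c i * Δ i b`. [folklore] -/
theorem sum_smul_apply {ι : Type*} (s : Finset ι) (c : ι → A) (Δ : ι → Derivation ℤ A A) (b : A) :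
    (∑ i ∈ s, c i • Δ i) b = ∑ i ∈ s, c i * Δ i b := by
  classical
  induction s using Finset.induction_on with
  | empty => simp
  | insert i s hi ih =>
    rw [Finset.sum_insert hi, Finset.sum_insert hi, Derivation.add_apply, Derivation.smul_apply, ih,
      smul_eq_mul]

section Determined

variable {ι : Type*} [Fintype ι] [DecidableEq ι]

/-- **Dual expansion.** If the dual family `Δ` of `y` determines derivations, every `ℤ`-derivation
is `∑ i, δ (y i) • Δ i`. [cite: Matsumura1987, §30 (dual derivations)] -/
theorem eq_sum_smul (y : ι → A) (Δ : ι → Derivation ℤ A A)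
    (hdual : ∀ i j, Δ i (y j) = if i = j then 1 else 0)
    (hdet : ∀ δ : Derivation ℤ A A, (∀ i, δ (y i) = 0) → δ = 0) (δ : Derivation ℤ A A) :
    δ = ∑ i, δ (y i) • Δ i := by
  refine eq_of_sub_eq_zero (hdet (δ - ∑ i, δ (y i) • Δ i) fun j => ?_)
  rw [Derivation.sub_apply, sum_smul_apply, sub_eq_zero, Finset.sum_eq_single j]
  · rw [hdual, if_pos rfl, mul_one]
  · intro i _ hij
    rw [hdual, if_neg hij, mul_zero]
  · intro hj
    exact absurd (Finset.mem_univ j) hj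

/-- Evaluated form: `δ b = ∑ i, δ (y i) * Δ i b`. [cite: Matsumura1987, §30 (dual derivations)] -/
theorem apply_eq_sum (y : ι → A) (Δ : ι → Derivation ℤ A A)
    (hdual : ∀ i j, Δ i (y j) = if i = j then 1 else 0)
    (hdet : ∀ δ : Derivation ℤ A A, (∀ i, δ (y i) = 0) → δ = 0) (δ : Derivation ℤ A A) (b : A) :
    δ b = ∑ i, δ (y i) * Δ i b := by
  conv_lhs => rw [eq_sum_smul y Δ hdual hdet δ]
  exact sum_smul_apply _ _ _ b

/-- **Content invertible ⇒ a unit coefficient.** In a local domain: if `h ≠ 0`, `Δ i f = h * a i`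
for all `i`, and some derivation `δ₀` has `δ₀ f = h * u` with `u` a unit, then some `a i` is a unit
(`u = ∑ i, δ₀ (y i) * a i` after cancelling `h`, and the non-units of a local ring form an ideal).
[folklore] -/
theorem exists_isUnit_coeff [IsDomain A] [IsLocalRing A] (y : ι → A) (Δ : ι → Derivation ℤ A A)
    (hdual : ∀ i j, Δ i (y j) = if i = j then 1 else 0)
    (hdet : ∀ δ : Derivation ℤ A A, (∀ i, δ (y i) = 0) → δ = 0) {f h : A} (hh : h ≠ 0)
    (a : ι → A) (ha : ∀ i, Δ i f = h * a i) (δ₀ : Derivation ℤ A A) {u : A} (hu : IsUnit u)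
    (hδ₀ : δ₀ f = h * u) : ∃ i, IsUnit (a i) := by
  have hsum : δ₀ f = h * ∑ i, δ₀ (y i) * a i := by
    rw [apply_eq_sum y Δ hdual hdet δ₀ f, Finset.mul_sum]
    exact Finset.sum_congr rfl fun i _ => by rw [ha i]; ring
  have hu' : u = ∑ i, δ₀ (y i) * a i := mul_left_cancel₀ hh (hδ₀ ▸ hsum)
  by_contra hcon
  push Not at hcon
  have hmem : (∑ i, δ₀ (y i) * a i) ∈ IsLocalRing.maximalIdeal A :=
    Ideal.sum_mem _ fun i _ => Ideal.mul_mem_left _ _ ((IsLocalRing.mem_maximalIdeal _).mpr (hcon i))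
  rw [← hu'] at hmem
  exact (IsLocalRing.mem_maximalIdeal u).mp hmem hu

end Determined

/-! ## The frame of `ker (d f / h)` -/

section Frame

variable {n : ℕ}

/-! The FRAME of the foliation `{δ | δ f = 0}` is the family
`j ↦ Δ (j+1) - (a (j+1) · (a 0)⁻¹) • Δ 0` (`j : Fin n`) for a family `Δ` with `Δ i f = h * a i` and
`a 0` a unit; it is written out in every statement (no definition is introduced). -/

/-- The frame kills `f`. [folklore] -/
theorem frame_apply_f {Δ : Fin (n + 1) → Derivation ℤ A A} {f h : A} {a : Fin (n + 1) → A}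
    (ha0 : IsUnit (a 0)) (ha : ∀ i, Δ i f = h * a i) (j : Fin n) : (Δ j.succ - (a j.succ * ↑(ha0.unit⁻¹)) • Δ 0) f = 0 := by
  rw [Derivation.sub_apply, Derivation.smul_apply, ha, ha, smul_eq_mul]
  have h1 : (a 0) * ↑(ha0.unit⁻¹) = 1 := by simp [IsUnit.mul_val_inv]
  linear_combination (-(h * a j.succ)) * h1

/-- The frame is dual to `y 1, …, y n`. [folklore] -/
theorem frame_apply_y_succ {y : Fin (n + 1) → A} {Δ : Fin (n + 1) → Derivation ℤ A A}
    {a : Fin (n + 1) → A} (ha0 : IsUnit (a 0)) (hdual : ∀ i j, Δ i (y j) = if i = j then 1 else 0)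
    (i j : Fin n) :
    (Δ i.succ - (a i.succ * ↑(ha0.unit⁻¹)) • Δ 0) (y j.succ) = if i = j then 1 else 0 := by
  rw [Derivation.sub_apply, Derivation.smul_apply, hdual, hdual, smul_eq_mul,
    if_neg (Fin.succ_ne_zero j).symm, mul_zero, sub_zero]
  simp only [Fin.succ_inj]

/-- Value of the frame on `y 0` (recorded for the exchange step). [folklore] -/
theorem frame_apply_y_zero {y : Fin (n + 1) → A} {Δ : Fin (n + 1) → Derivation ℤ A A}
    {a : Fin (n + 1) → A} (ha0 : IsUnit (a 0)) (hdual : ∀ i j, Δ i (y j) = if i = j then 1 else 0)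
    (i : Fin n) :
    (Δ i.succ - (a i.succ * ↑(ha0.unit⁻¹)) • Δ 0) (y 0) = -(a i.succ * ↑(ha0.unit⁻¹)) := by
  rw [Derivation.sub_apply, Derivation.smul_apply, hdual, hdual, smul_eq_mul,
    if_neg (Fin.succ_ne_zero i), if_pos rfl, mul_one, zero_sub]

/-- **Uniqueness on the foliation.** In a domain with `h ≠ 0` and `a 0` a unit: a `ℤ`-derivation
killing `f` and `y 1, …, y n` is zero (it is `δ (y 0) • Δ 0`, and `δ f = δ (y 0) * h * a 0`).
[folklore] -/
theorem eq_zero_of_apply_eq_zero [IsDomain A] {y : Fin (n + 1) → A}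
    {Δ : Fin (n + 1) → Derivation ℤ A A} {f h : A} {a : Fin (n + 1) → A} (ha0 : IsUnit (a 0))
    (hdual : ∀ i j, Δ i (y j) = if i = j then 1 else 0)
    (hdet : ∀ δ : Derivation ℤ A A, (∀ i, δ (y i) = 0) → δ = 0) (hh : h ≠ 0)
    (ha : ∀ i, Δ i f = h * a i) (δ : Derivation ℤ A A) (hf : δ f = 0)
    (hy : ∀ j : Fin n, δ (y j.succ) = 0) : δ = 0 := by
  have hδ : δ = δ (y 0) • Δ 0 := by
    rw [eq_sum_smul y Δ hdual hdet δ, Fin.sum_univ_succ, Finset.sum_eq_zero fun j _ => ?_, add_zero]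
    · conv_rhs => rw [Derivation.smul_apply, hdual, if_pos rfl, smul_eq_mul, mul_one]
    · rw [hy j, zero_smul]
  have hf' : δ (y 0) * (h * a 0) = 0 := by
    have := hf
    rw [hδ, Derivation.smul_apply, ha, smul_eq_mul] at this
    exact this
  have hy0 : δ (y 0) = 0 := by
    rcases mul_eq_zero.mp hf' with h0 | h0
    · exact h0
    · exact absurd h0 (mul_ne_zero hh (IsUnit.ne_zero ha0))
  refine hdet δ fun i => ?_
  rw [hδ, Derivation.smul_apply, hdual, hy0, zero_smul]

/-- **The frame commutes.** [folklore] -/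
theorem frame_comm [IsDomain A] {y : Fin (n + 1) → A} {Δ : Fin (n + 1) → Derivation ℤ A A}
    {f h : A} {a : Fin (n + 1) → A} (ha0 : IsUnit (a 0))
    (hdual : ∀ i j, Δ i (y j) = if i = j then 1 else 0)
    (hdet : ∀ δ : Derivation ℤ A A, (∀ i, δ (y i) = 0) → δ = 0) (hh : h ≠ 0)
    (ha : ∀ i, Δ i f = h * a i) (i j : Fin n) (b : A) :
    (Δ i.succ - (a i.succ * ↑(ha0.unit⁻¹)) • Δ 0) ((Δ j.succ - (a j.succ * ↑(ha0.unit⁻¹)) • Δ 0) b) =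
      (Δ j.succ - (a j.succ * ↑(ha0.unit⁻¹)) • Δ 0) ((Δ i.succ - (a i.succ * ↑(ha0.unit⁻¹)) • Δ 0) b) := by
  have hc : ⁅Δ i.succ - (a i.succ * ↑(ha0.unit⁻¹)) • Δ 0, Δ j.succ - (a j.succ * ↑(ha0.unit⁻¹)) • Δ 0⁆ = 0 := by
    refine eq_zero_of_apply_eq_zero ha0 hdual hdet hh ha _ ?_ fun l => ?_
    · rw [Derivation.commutator_apply, frame_apply_f ha0 ha, frame_apply_f ha0 ha, map_zero,
        map_zero, sub_zero]
    · rw [Derivation.commutator_apply, frame_apply_y_succ ha0 hdual, frame_apply_y_succ ha0 hdual]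
      split_ifs <;> simp
  have := congrArg (fun D : Derivation ℤ A A => D b) hc
  simp only [Derivation.commutator_apply, Derivation.zero_apply, sub_eq_zero] at this
  exact this

/-- **The frame is `p`-nilpotent** in characteristic `p`: `(frame i)^[p] = 0`.
[cite: Matsumura1987, §25 (p-th powers of derivations)] -/
theorem iterate_frame_prime [IsDomain A] (p : ℕ) [Fact p.Prime] [CharP A p] {y : Fin (n + 1) → A}
    {Δ : Fin (n + 1) → Derivation ℤ A A} {f h : A} {a : Fin (n + 1) → A} (ha0 : IsUnit (a 0))
    (hdual : ∀ i j, Δ i (y j) = if i = j then 1 else 0)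
    (hdet : ∀ δ : Derivation ℤ A A, (∀ i, δ (y i) = 0) → δ = 0) (hh : h ≠ 0)
    (ha : ∀ i, Δ i f = h * a i) (i : Fin n) (b : A) :
    (⇑(Δ i.succ - (a i.succ * ↑(ha0.unit⁻¹)) • Δ 0))^[p] b = 0 := by
  obtain ⟨q, hq⟩ : ∃ q, p = q + 2 := ⟨p - 2, (Nat.sub_add_cancel (Fact.out : p.Prime).two_le).symm⟩
  have hD : iteratePrime (Δ i.succ - (a i.succ * ↑(ha0.unit⁻¹)) • Δ 0) p = 0 := by
    refine eq_zero_of_apply_eq_zero ha0 hdual hdet hh ha _ ?_ fun l => ?_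
    · rw [iteratePrime_apply, hq, Function.iterate_succ_apply, frame_apply_f ha0 ha]
      exact Function.iterate_fixed (map_zero _) _
    · rw [iteratePrime_apply, hq, Function.iterate_succ_apply, frame_apply_y_succ ha0 hdual,
        Function.iterate_succ_apply]
      have h0 : (Δ i.succ - (a i.succ * ↑(ha0.unit⁻¹)) • Δ 0) (if i = l then 1 else 0) = 0 := by
        split_ifs
        · exact Derivation.map_one_eq_zero _
        · exact map_zero _
      rw [h0]
      exact Function.iterate_fixed (map_zero _) _
  have := congrArg (fun D : Derivation ℤ A A => D b) hD
  simpa only [iteratePrime_apply, Derivation.zero_apply] using this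

end Frame

/-! ## Packaging: content invertible ⇒ a commuting `p`-nilpotent frame (after reindexing) -/

section Package

variable {d : ℕ}

/-- Duality is stable under reindexing both families by the same bijection. [folklore] -/
theorem dual_reindex {ι : Type*} [DecidableEq ι] (y : ι → A) (Δ : ι → Derivation ℤ A A)
    (hdual : ∀ i j, Δ i (y j) = if i = j then 1 else 0) (e : Fin d ≃ ι) (i j : Fin d) :
    Δ (e i) (y (e j)) = if i = j then 1 else 0 := by
  simp only [hdual, EmbeddingLike.apply_eq_iff_eq]

/-- Determination is stable under reindexing by a bijection. [folklore] -/
theorem det_reindex {ι : Type*} (y : ι → A)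
    (hdet : ∀ δ : Derivation ℤ A A, (∀ i, δ (y i) = 0) → δ = 0) (e : Fin d ≃ ι)
    (δ : Derivation ℤ A A) (hδ : ∀ i, δ (y (e i)) = 0) : δ = 0 :=
  hdet δ fun i => by simpa using hδ (e.symm i)

/-- **L1 `contentFrame`, packaged.** Let `A` be a local domain of prime characteristic `p`, `y : Fin d → A`
a family with dual derivations `Δ` determining `Der_ℤ(A)`, and `f ∈ A` with INVERTIBLE CONTENT: `h ≠ 0`
divides every `δ f` and some `δ₀ f = h * u` with `u` a unit. Then, after reindexing `y` by a bijection
`e : Fin (n + 1) ≃ Fin d`, there is a COMMUTING, `p`-NILPOTENT family `D : Fin n → Der_ℤ(A)` killing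
`f`, DUAL to `y (e 1), …, y (e n)`, such that every derivation killing `f` and these `y`'s is zero;
moreover `Δ (e 0) f ≠ 0` while `Δ (e 0)` kills `y (e 1), …, y (e n)` (the exchange witness).
[cite: Matsumura1987, §25, §30] [folklore] -/
theorem exists_frame [IsDomain A] [IsLocalRing A] (p : ℕ) [Fact p.Prime] [CharP A p]
    (y : Fin d → A) (Δ : Fin d → Derivation ℤ A A) (hdual : ∀ i j, Δ i (y j) = if i = j then 1 else 0)
    (hdet : ∀ δ : Derivation ℤ A A, (∀ i, δ (y i) = 0) → δ = 0) {f h : A} (hh : h ≠ 0)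
    (hdiv : ∀ δ : Derivation ℤ A A, h ∣ δ f) (δ₀ : Derivation ℤ A A) {u : A} (hu : IsUnit u)
    (hδ₀ : δ₀ f = h * u) :
    ∃ (n : ℕ) (e : Fin (n + 1) ≃ Fin d) (D : Fin n → Derivation ℤ A A),
      (∀ j, D j f = 0) ∧
      (∀ i j, D i (y (e j.succ)) = if i = j then 1 else 0) ∧
      (∀ i j b, D i (D j b) = D j (D i b)) ∧
      (∀ i b, (⇑(D i))^[p] b = 0) ∧
      (∀ δ : Derivation ℤ A A, δ f = 0 → (∀ j : Fin n, δ (y (e j.succ)) = 0) → δ = 0) ∧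
      Δ (e 0) f ≠ 0 ∧ (∀ j : Fin n, Δ (e 0) (y (e j.succ)) = 0) := by
  classical
  choose c hc using hdiv
  let a : Fin d → A := fun i => c (Δ i)
  have ha : ∀ i, Δ i f = h * a i := fun i => hc (Δ i)
  obtain ⟨i₀, hi₀⟩ := exists_isUnit_coeff y Δ hdual hdet hh a ha δ₀ hu hδ₀
  obtain ⟨n, rfl⟩ : ∃ n, d = n + 1 := Nat.exists_eq_succ_of_ne_zero (Fin.pos i₀).ne'
  let e : Fin (n + 1) ≃ Fin (n + 1) := Equiv.swap 0 i₀
  have hdual' : ∀ i j, (Δ ∘ e) i ((y ∘ e) j) = if i = j then 1 else 0 :=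
    fun i j => dual_reindex y Δ hdual e i j
  have hdet' : ∀ δ : Derivation ℤ A A, (∀ i, δ ((y ∘ e) i) = 0) → δ = 0 :=
    fun δ hδ => det_reindex y hdet e δ hδ
  have ha' : ∀ i, (Δ ∘ e) i f = h * (a ∘ e) i := fun i => ha (e i)
  have ha0 : IsUnit ((a ∘ e) 0) := by
    simpa [e, Equiv.swap_apply_left] using hi₀
  refine ⟨n, e, fun j => (Δ ∘ e) j.succ - ((a ∘ e) j.succ * ↑(ha0.unit⁻¹)) • (Δ ∘ e) 0,
    fun j => frame_apply_f ha0 ha' j,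
    fun i j => frame_apply_y_succ ha0 hdual' i j,
    fun i j b => frame_comm ha0 hdual' hdet' hh ha' i j b,
    fun i b => iterate_frame_prime p ha0 hdual' hdet' hh ha' i b,
    fun δ hf hy => eq_zero_of_apply_eq_zero ha0 hdual' hdet' hh ha' δ hf hy, ?_, fun j => ?_⟩
  · rw [show Δ (e 0) f = h * (a ∘ e) 0 from ha' 0]
    exact mul_ne_zero hh ha0.ne_zero
  · rw [show Δ (e 0) (y (e j.succ)) = (Δ ∘ e) 0 ((y ∘ e) j.succ) from rfl, hdual',
      if_neg (Fin.succ_ne_zero j).symm]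

end Package

/-! ## The determination hypothesis from a spanning set of monomials over `p`-th powers -/

/-- A `ℤ`-derivation kills `p`-th powers in characteristic `p`. [cite: Matsumura1987, §25] -/
theorem apply_pow_prime_eq_zero (p : ℕ) [CharP A p] (δ : Derivation ℤ A A) (b : A) :
    δ (b ^ p) = 0 := by
  rw [δ.leibniz_pow, ← Nat.cast_smul_eq_nsmul A p, CharP.cast_eq_zero A p, zero_smul]

/-- A derivation killing every `y i` kills every monomial `∏ i, y i ^ α i`. [folklore] -/
theorem apply_prod_pow_eq_zero {ι : Type*} (s : Finset ι) (y : ι → A) (α : ι → ℕ)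
    (δ : Derivation ℤ A A) (hy : ∀ i, δ (y i) = 0) : δ (∏ i ∈ s, y i ^ α i) = 0 := by
  classical
  induction s using Finset.induction_on with
  | empty => simp
  | insert i s hi ih =>
    rw [Finset.prod_insert hi, Derivation.leibniz, ih, smul_zero, zero_add, Derivation.leibniz_pow, hy,
      smul_zero, smul_zero, smul_zero]

/-- **Determination from a `p`-basis-type spanning set.** If `S₀ ⊆ A` is a subring consisting of
`p`-th powers (characteristic `p`) and `A` is spanned over `S₀` by a set `M` of elements killed by
`δ`, then `δ = 0`. Applied with `S₀ = ρ(A)` and `M` the monomials in a regular system of parameters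
(the tree's `span_frobeniusPower_monomials_eq_top_of_isFFinite`), it says that `Der_ℤ(A)` is
determined by the values on the parameters. [cite: Matsumura1987, §30 (Thm. 30.6, p-bases)] -/
theorem derivation_eq_zero_of_span (p : ℕ) [CharP A p] (S₀ : Subring A)
    (hS₀ : ∀ s ∈ S₀, ∃ b : A, b ^ p = s) (M : Set A) (hspan : Submodule.span S₀ M = ⊤)
    (δ : Derivation ℤ A A) (hM : ∀ m ∈ M, δ m = 0) : δ = 0 := by
  have key : ∀ b : A, δ b = 0 := by
    intro b
    have hb : b ∈ Submodule.span S₀ M := by rw [hspan]; exact Submodule.mem_top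
    induction hb using Submodule.span_induction with
    | mem x hx => exact hM x hx
    | zero => exact map_zero _
    | add x y' _ _ hx hy => rw [map_add, hx, hy, add_zero]
    | smul c x _ hx =>
      obtain ⟨b, hb⟩ := hS₀ c c.2
      rw [Subring.smul_def, smul_eq_mul, Derivation.leibniz, hx, smul_zero, zero_add, ← hb,
        apply_pow_prime_eq_zero p δ b, smul_zero]
  ext b
  rw [key, Derivation.zero_apply]

end ContentFrame

end Summit.ResolutionOfSingularities.ResolutionOfSingularities.Theorems.SwitchingDichotomy
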